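import Mathlib.GroupTheory.QuotientGroup.Basic
import Mathlib.GroupTheory.Index
import Literature.Computability.AlgebraicComplexity.CohnUmansDihedralSubgroupTPP
import HarnessLib

/-!
# The centre of a quotient has index dividing `[G : Z(G)]`; the class-2 TPP bound passes up from quotients (Murthy 2026, Lemma 2.13)

Topic `Literature/Computability/AlgebraicComplexity` (group-theoretic matrix multiplication: subgroup
TPP triples, the tree's `DihedralSubgroups.SubgroupTPP`; companion of `SubgroupTPPQuotient.lean`,
Murthy 2026 Lemma 2.10, the other half of the paper's induction step).

S. R. Murthy, *On the triple product property for subgroups of finite nilpotent groups of class 2*,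
arXiv:2602.15796v1 (2026), Lemma 2.13, p. 9, verbatim (`ρ₀(G)` = the largest `|S||T||U|/|G|` over
subgroup TPP triples of `G`):

> **Lemma 2.13.** If `G` is a group with a normal subgroup `N` such that
> `ρ₀(G/N) ≤ √|G/N : Z(G/N)|` then `ρ₀(G/N) ≤ √|G : Z(G)|`.
> *Proof.* […] Note that `Z(G)N/N ≤ Z(G/N)`, where `Z(G)N/N ≅ Z(G)/(Z(G) ∩ N)` and
> `|Z(G)N/N| = |Z(G)|/|Z(G) ∩ N|`, and therefore `1/|Z(G/N)| ≤ 1/|Z(G)N/N| = |Z(G) ∩ N|/|Z(G)|`. […]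

## What is here (all proved; 0 definitions, 0 named facts)

* `Murthy2026.map_center_le_center_quotient` — `Z(G)N/N ≤ Z(G/N)`;
* `Murthy2026.index_center_quotient_dvd` — the group-theoretic content of the proof:
  `[G/N : Z(G/N)]` divides `[G : Z(G)]` (for every normal `N`; no finiteness needed);
* `Murthy2026_lemma213` — **Lemma 2.13** in the tree's per-triple language (no `ρ₀` symbol): if every
  subgroup TPP triple `(S̄, T̄, Ū)` of `G/N` satisfies `(|S̄||T̄||Ū|)² ≤ |G/N|² · [G/N : Z(G/N)]`
  (i.e. `ρ₀(G/N) ≤ √[G/N : Z(G/N)]`), then every such triple satisfies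
  `(|S̄||T̄||Ū|)² ≤ |G/N|² · [G : Z(G)]` (i.e. `ρ₀(G/N) ≤ √[G : Z(G)]`).

(The paper uses Lemma 2.13 with Lemma 2.10 in the induction behind its Thm. 3.1, whose own printed
proof has an unsubstantiated step — see `NormalizerBarrier.lean`, evasions (vi); this file only
records the lemma.)

## References
* S. R. Murthy, arXiv:2602.15796v1 (2026): Lemma 2.13 with proof, p. 9. [Murthy2026]
-/

namespace Literature.Computability.AlgebraicComplexity

open DihedralSubgroups

variable {G : Type} [Group G]

namespace Murthy2026

/-- `Z(G)N/N ≤ Z(G/N)`: the image of the centre in a quotient is central.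
[cite: Murthy2026, Lemma 2.13 (proof)] -/
theorem map_center_le_center_quotient (N : Subgroup G) [N.Normal] :
    (Subgroup.center G).map (QuotientGroup.mk' N) ≤ Subgroup.center (G ⧸ N) := by
  rintro _ ⟨z, hz, rfl⟩
  rw [Subgroup.mem_center_iff]
  intro q
  obtain ⟨g, rfl⟩ := QuotientGroup.mk'_surjective N q
  rw [← map_mul, ← map_mul, Subgroup.mem_center_iff.1 hz g]

/-- **`[G/N : Z(G/N)]` divides `[G : Z(G)]`** for every normal subgroup `N` (since
`Z(G)N/N ≤ Z(G/N)` and `[G/N : Z(G)N/N]` divides `[G : Z(G)]`) — the group-theoretic content of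
the proof of Lemma 2.13. [cite: Murthy2026, Lemma 2.13 (proof)] -/
theorem index_center_quotient_dvd (N : Subgroup G) [N.Normal] :
    (Subgroup.center (G ⧸ N)).index ∣ (Subgroup.center G).index :=
  (Subgroup.index_dvd_of_le (map_center_le_center_quotient N)).trans
    (Subgroup.index_map_dvd _ (QuotientGroup.mk'_surjective N))

end Murthy2026

/-- **Murthy 2026, Lemma 2.13** (per-triple form; `ρ₀(Q) ≤ √[Q : Z(Q)]` is rendered as
"`(|S̄||T̄||Ū|)² ≤ |Q|² · [Q : Z(Q)]` for every subgroup TPP triple of `Q = G/N`"): if the subgroup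
TPP triples of `G/N` obey the class-2-type bound with `[G/N : Z(G/N)]`, they obey it with
`[G : Z(G)]`. [cite: Murthy2026, Lemma 2.13] -/
theorem Murthy2026_lemma213 [Finite G] (N : Subgroup G) [N.Normal]
    (h : ∀ S T U : Subgroup (G ⧸ N), SubgroupTPP S T U →
      (Nat.card S * Nat.card T * Nat.card U) ^ 2 ≤
        Nat.card (G ⧸ N) ^ 2 * (Subgroup.center (G ⧸ N)).index)
    {S T U : Subgroup (G ⧸ N)} (hSTU : SubgroupTPP S T U) :
    (Nat.card S * Nat.card T * Nat.card U) ^ 2 ≤ Nat.card (G ⧸ N) ^ 2 * (Subgroup.center G).index := by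
  refine (h S T U hSTU).trans (Nat.mul_le_mul_left _ ?_)
  exact Nat.le_of_dvd (Nat.pos_of_ne_zero Subgroup.index_ne_zero_of_finite)
    (Murthy2026.index_center_quotient_dvd N)

end Literature.Computability.AlgebraicComplexity
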